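import Mathlib.Combinatorics.SetFamily.Compression.Down
import Mathlib.Tactic
import HarnessLib
import HarnessLib.Audit.Tags
import Summits.CriticalPhenomena.PercolationContinuityZ3.Theorems.PercNearOneGluingNoHeavyLowerTailSahiRainbowStrictPure

/-!
# The strict rainbow lemma, V: the CORE residual (fully redundant, many members)

Support file (seat `prim-masterthm-p1`, gen 40; `--supports stmt-CriticalPhenomena-4575`).  One typed statement (`PinnedResidualCore`) and the
reduction theorems; no `sorry`, standard axioms.  Memo `run/shared/lean/prim/prim-masterthm/FROM-prim-masterthm-p1-g40-STRICT-RAINBOW.md` §2–§3.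

Two further free reductions of the residual of `…SahiRainbowStrict` / `…SahiRainbowStrictPure`, by an inner induction on the number of members:
* MEMBER DELETION: if some member `p` of `𝒞` owns a colour (`rainbowMeets F (𝒞.erase p) ≠ rainbowMeets F 𝒞`), then the weak inequality for
  `𝒞.erase p` gives it for `𝒞`; so the residual may assume `𝒞` FULLY REDUNDANT (`rainbowMeets F (𝒞.erase p) = rainbowMeets F 𝒞` for every
  member `p`);
* MANY MEMBERS: a fully pinned family sees every singleton (`card_add_one_le_card_rainbowMeets_of_fully_pinned`), so the residual may assume
  `#F + 2 ≤ #𝒞`.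
`PinnedResidualCore` is `PinnedResidualMixed` with these two extra hypotheses; `rainbowStrict_of_pinnedResidualCore`,
`rainbowMeetCojoin_of_pinnedResidualCore`.  Census of the core (`prim-masterthm-p1/code-g40/c/frpin.c`, `resid2.c`, `cert.c`): empty on `2^≤2`;
on `2^3` the two tight quadruples `{∅,01,02,12}`, `{F,0,1,2}`; 16 families on `2^4` (N = 8, slack 3); 4 370 on `2^5` (slack ≥ 3), of which 2 602
have no point with pure pairs and no doubled member.  HONEST FRAMING: `RainbowMeetCojoin`, `RainbowStrict` and the residual statements remain
OPEN. [this work]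
-/

namespace Summit.CriticalPhenomena.PercolationContinuityZ3.Theorems.SahiColouredDaykin

open Finset

variable {α : Type*} [DecidableEq α]

/-- **The CORE residual (typed).**  `PinnedResidualMixed` restricted to FULLY REDUNDANT families with at least `#F + 2` members.
[this work] [status: open] -/
@[conjecture] def PinnedResidualCore (α : Type*) [DecidableEq α] : Prop :=
  ∀ (F : Finset α) (𝒜 : Finset (Finset α)), (∀ a ∈ 𝒜, a ⊆ F) → (∀ a ∈ 𝒜, F \ a ∉ 𝒜) → RainbowDegenerate F 𝒜 →
    (∀ r ∈ F, ¬ ∀ b ∈ 𝒜.memberSubfamily r ∪ 𝒜.nonMemberSubfamily r,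
      (F.erase r) \ b ∉ 𝒜.memberSubfamily r ∪ 𝒜.nonMemberSubfamily r) →
    (∀ r ∈ F, 𝒜.memberSubfamily r ∩ 𝒜.nonMemberSubfamily r = ∅ →
      ¬ ((∀ b ∈ 𝒜.memberSubfamily r ∪ 𝒜.nonMemberSubfamily r, (F.erase r) \ b ∈ 𝒜.memberSubfamily r ∪ 𝒜.nonMemberSubfamily r →
            b ∈ 𝒜.nonMemberSubfamily r ∧ (F.erase r) \ b ∈ 𝒜.nonMemberSubfamily r) ∨
         (∀ b ∈ 𝒜.memberSubfamily r ∪ 𝒜.nonMemberSubfamily r, (F.erase r) \ b ∈ 𝒜.memberSubfamily r ∪ 𝒜.nonMemberSubfamily r →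
            b ∈ 𝒜.memberSubfamily r ∧ (F.erase r) \ b ∈ 𝒜.memberSubfamily r))) →
    (∀ p ∈ 𝒜, rainbowMeets F (𝒜.erase p) = rainbowMeets F 𝒜) →
    #F + 2 ≤ #𝒜 →
    (∀ r ∈ F, RainbowStrictOn (F.erase r)) → #𝒜 ≤ #(rainbowMeets F 𝒜)

/-- **REDUCTION TO THE CORE.**  The strict rainbow lemma follows from the core residual statement: induction on the ground set, and inside
it on the number of members (member deletion for non-redundant families; the singleton colours for families with at most `#F + 1` members).
[this work] -/
theorem rainbowStrict_of_pinnedResidualCore (hres : PinnedResidualCore α) : RainbowStrict α := by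
  intro F
  induction' hn : #F using Nat.strong_induction_on with n ihn generalizing F
  have IH : ∀ r ∈ F, RainbowStrictOn (F.erase r) := fun r hr =>
    ihn #(F.erase r) (by rw [← hn]; exact card_erase_lt_of_mem hr) (F.erase r) rfl
  -- inner induction on the number of members, for the weak inequality
  have weak : ∀ (N : ℕ) (𝒞 : Finset (Finset α)), #𝒞 = N → (∀ c ∈ 𝒞, c ⊆ F) → (∀ c ∈ 𝒞, F \ c ∉ 𝒞) →
      #𝒞 ≤ #(rainbowMeets F 𝒞) := by
    intro N
    induction' N using Nat.strong_induction_on with N ihN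
    intro 𝒞 h𝒞 h𝒞F hcf
    have hF : 2 ≤ #𝒞 → F.Nonempty := by
      intro h2
      rw [nonempty_iff_ne_empty]; rintro rfl
      obtain ⟨c, hc, d, hd, hcd⟩ := one_lt_card.1 h2
      exact hcd ((subset_empty.1 (h𝒞F c hc)).trans (subset_empty.1 (h𝒞F d hd)).symm)
    by_cases h2 : 2 ≤ #𝒞
    swap
    · have : 0 < #(rainbowMeets F 𝒞) := card_pos.2 ⟨∅, mem_rainbowMeets_iff.2 (Or.inl rfl)⟩
      omega
    by_cases hnd : RainbowDegenerate F 𝒞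
    swap
    · obtain ⟨r, hr⟩ := hF h2
      have := card_add_one_le_card_rainbowMeets_of_not_degenerate hr h𝒞F hcf h2 hnd (IH r hr); omega
    by_cases hun : ∃ r ∈ F, ∀ b ∈ 𝒞.memberSubfamily r ∪ 𝒞.nonMemberSubfamily r,
        (F.erase r) \ b ∉ 𝒞.memberSubfamily r ∪ 𝒞.nonMemberSubfamily r
    · obtain ⟨r, hr, h𝔅⟩ := hun
      exact card_le_card_rainbowMeets_of_unpinned hr h𝒞F hcf h𝔅 (IH r hr)
    push Not at hun
    have hpin : ∀ r ∈ F, ¬ ∀ b ∈ 𝒞.memberSubfamily r ∪ 𝒞.nonMemberSubfamily r,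
        (F.erase r) \ b ∉ 𝒞.memberSubfamily r ∪ 𝒞.nonMemberSubfamily r :=
      fun r hr h => by obtain ⟨b, hb, hb'⟩ := hun r hr; exact h b hb hb'
    by_cases hmix : ∀ r ∈ F, 𝒞.memberSubfamily r ∩ 𝒞.nonMemberSubfamily r = ∅ →
        ¬ ((∀ b ∈ 𝒞.memberSubfamily r ∪ 𝒞.nonMemberSubfamily r, (F.erase r) \ b ∈ 𝒞.memberSubfamily r ∪ 𝒞.nonMemberSubfamily r →
              b ∈ 𝒞.nonMemberSubfamily r ∧ (F.erase r) \ b ∈ 𝒞.nonMemberSubfamily r) ∨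
           (∀ b ∈ 𝒞.memberSubfamily r ∪ 𝒞.nonMemberSubfamily r, (F.erase r) \ b ∈ 𝒞.memberSubfamily r ∪ 𝒞.nonMemberSubfamily r →
              b ∈ 𝒞.memberSubfamily r ∧ (F.erase r) \ b ∈ 𝒞.memberSubfamily r))
    swap
    · push Not at hmix
      obtain ⟨r, hr, hQ, hpure⟩ := hmix
      exact card_le_card_rainbowMeets_of_pinned_pure hr h𝒞F hcf h2 hQ hpure (IH r hr)
    -- member deletion: a non-redundant member
    by_cases hfr : ∀ p ∈ 𝒞, rainbowMeets F (𝒞.erase p) = rainbowMeets F 𝒞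
    swap
    · push Not at hfr
      obtain ⟨p, hp, hne⟩ := hfr
      have hsub : rainbowMeets F (𝒞.erase p) ⊆ rainbowMeets F 𝒞 := rainbowMeets_mono F (erase_subset p 𝒞)
      have hlt : #(rainbowMeets F (𝒞.erase p)) < #(rainbowMeets F 𝒞) :=
        card_lt_card (Finset.ssubset_iff_subset_ne.2 ⟨hsub, hne⟩)
      have hcard : #(𝒞.erase p) = #𝒞 - 1 := card_erase_of_mem hp
      have ih := ihN (#𝒞 - 1) (by omega) (𝒞.erase p) hcard (fun c hc => h𝒞F c (mem_of_mem_erase hc))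
        (fun c hc h => hcf c (mem_of_mem_erase hc) (mem_of_mem_erase h))
      omega
    -- many members
    by_cases hbig : #F + 2 ≤ #𝒞
    swap
    · have := card_add_one_le_card_rainbowMeets_of_fully_pinned h𝒞F hcf h2 hpin; omega
    exact hres F 𝒞 h𝒞F hcf hnd hpin hmix hfr hbig IH
  intro 𝒞 h𝒞F hcf
  refine ⟨weak #𝒞 𝒞 rfl h𝒞F hcf, fun h2 hnd => ?_⟩
  have hF : F.Nonempty := by
    rw [nonempty_iff_ne_empty]; rintro rfl
    obtain ⟨c, hc, d, hd, hcd⟩ := one_lt_card.1 h2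
    exact hcd ((subset_empty.1 (h𝒞F c hc)).trans (subset_empty.1 (h𝒞F d hd)).symm)
  obtain ⟨r, hr⟩ := hF
  exact card_add_one_le_card_rainbowMeets_of_not_degenerate hr h𝒞F hcf h2 hnd (IH r hr)

/-- **The rainbow lemma follows from the core residual statement.** [this work] -/
theorem rainbowMeetCojoin_of_pinnedResidualCore (hres : PinnedResidualCore α) : RainbowMeetCojoin α :=
  rainbowMeetCojoin_of_rainbowStrict (rainbowStrict_of_pinnedResidualCore hres)

end Summit.CriticalPhenomena.PercolationContinuityZ3.Theorems.SahiColouredDaykin
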